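import Mathlib
import Summits.Ventures.PercRepro2.Star3Key5cHH12
import Summits.Ventures.PercRepro2.Star3Key5cLL11
import Summits.Ventures.PercRepro2.Star3Key5cHL13
import Summits.Ventures.PercRepro2.Star3Key5cLH11
import Summits.Ventures.PercRepro2.Star3Key5W14

/-!
# THE ALGEBRAIC KEY OF THE THREE-PIN STAR's `D·Z`-CHORD (blind cell PercRepro2, night-1 g26, landed by night-1 g27; proofs/NIGHT1-G26.md §6)

**`star3_key_dz`**: for `a₃` joined to `o`, `a₁`, `a₂` by the pins `r`, `t1`, `t2`, the cleared `D·Z`-chord along the `o`-edge `f = {o, a₁}` of weight `q`, `(1 − q)·Gc(p⁰)·(D·Z)(p) ≤ Gc(p)·(D·Z)(p⁰)`, holds for the star's polynomials (Star3Defs.lean) in the masses of the base instance, given: the `o`-edge pins and g18's couplings (`Z1 = Z0 − Ho0`, `L1 = Lb0 − HL0 + W`), `0 < Z0`, `0 ≤ Lo0, Ho0, Z0 − Lo0 − Ho0, W`, the pins and `q` in `[0, 1]`, and the FOUR COVARIANCE SIGNS at `p[f ↦ 0]`: `Z0·LL0 ≥ Lo0·Lb0`, `Z0·HH0 ≥ Ho0·Hb0`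 (same-cluster, `covC_same_nonneg`), `Z0·LH0 ≤ Lo0·Hb0`, `Z0·HL0 ≤ Ho0·Lb0` (cross-cluster, `covC_cross_nonpos`).  Proof: `assembly3` writes `Z0²` times the deficit as `Σ_c E3_c · c + E3_W · W`; `E3_cHH, E3_cLL, E3_W ≥ 0` and `E3_cHL, E3_cLH ≤ 0` on the box (`E3_c_sign`).  No avoid-slack enters — the `D·Z` normaliser is exactly what the three-pin star needs (the `D`-chord is false there, NEG-206).  Own code; standard axioms.
-/

namespace Summit.Ventures.PercRepro2

namespace Mix

namespace OStar3

section Key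

variable {R : Type*} [Field R] [LinearOrder R] [IsStrictOrderedRing R]

/-- **THE KEY INEQUALITY OF THE THREE-PIN STAR** (`D·Z` normaliser): `(1 − q)·Gc(p⁰)·N(p) ≤ Gc(p)·N(p⁰)` for the star's polynomials. -/
theorem star3_key_dz (Z0 Lo0 Ho0 Lb0 Hb0 LL0 LH0 HL0 HH0 W q Zq Loq Hoq Lbq Hbq LLq LHq HLq HHq Wq Z1 L1 r t1 t2 : R) (hZq : Zq = (1 - q) * Z0 + q * Z1) (hLoq : Loq = (1 - q) * Lo0 + q * Z1) (hHoq : Hoq = (1 - q) * Ho0) (hLbq : Lbq = (1 - q) * Lb0 + q * L1) (hHbq : Hbq = (1 - q) * Hb0 + q * (Hb0 - HH0)) (hLLq : LLq = (1 - q) * LL0 + q * L1) (hLHq : LHq = (1 - q) * LH0 + q * (Hb0 - HH0)) (hHLq : HLq = (1 - q) * HL0) (hHHq : HHq = (1 - q) * HH0) (hWq : Wq = (1 - q) * W) (hZ1 : Z1 = Z0 - Ho0) (hL1 : L1 = Lb0 - HL0 + W)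
    (hZ0 : 0 < Z0) (hLo : 0 ≤ Lo0) (hHo : 0 ≤ Ho0) (hN : 0 ≤ Z0 - Lo0 - Ho0) (hW : 0 ≤ W)
    (hq0 : 0 ≤ q) (hq1 : q ≤ 1) (hr0 : 0 ≤ r) (hr1 : r ≤ 1) (ht10 : 0 ≤ t1) (ht11 : t1 ≤ 1) (ht20 : 0 ≤ t2) (ht21 : t2 ≤ 1)
    (hsLL : 0 ≤ Z0 * LL0 - Lo0 * Lb0) (hsHH : 0 ≤ Z0 * HH0 - Ho0 * Hb0)
    (hsLH : Z0 * LH0 - Lo0 * Hb0 ≤ 0) (hsHL : Z0 * HL0 - Ho0 * Lb0 ≤ 0) :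
    (1 - q) * Gc3_mix Z0 Lo0 Ho0 Lb0 Hb0 LL0 LH0 HL0 HH0 Z1 L1 W r t1 t2 * N3_mix Zq Loq Hoq Lbq Hbq LLq LHq HLq HHq Z1 L1 Wq r t1 t2 ≤
      Gc3_mix Zq Loq Hoq Lbq Hbq LLq LHq HLq HHq Z1 L1 Wq r t1 t2 * N3_mix Z0 Lo0 Ho0 Lb0 Hb0 LL0 LH0 HL0 HH0 Z1 L1 W r t1 t2 := by
  have hA := assembly3 Z0 Lo0 Ho0 Lb0 Hb0 LL0 LH0 HL0 HH0 W q Zq Loq Hoq Lbq Hbq LLq LHq HLq HHq Wq Z1 L1 r t1 t2 hZq hLoq hHoq hLbq hHbq hLLq hLHq hHLq hHHq hWq hZ1 hL1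
  have hZ : Z0 = Lo0 + Ho0 + (Z0 - Lo0 - Ho0) := by ring
  have hHH := E3_cHH_sign Z0 Lo0 Ho0 (Z0 - Lo0 - Ho0) q (1 - q) r (1 - r) t1 (1 - t1) t2 (1 - t2) hZ rfl rfl rfl rfl
    hLo hHo hN hq0 (by linarith) ht10 (by linarith) ht20 (by linarith) hr0 (by linarith)
  have hLL := E3_cLL_sign Z0 Lo0 Ho0 (Z0 - Lo0 - Ho0) q (1 - q) r (1 - r) t1 (1 - t1) t2 (1 - t2) hZ rfl rfl rfl rfl
    hLo hHo hN hq0 (by linarith) ht10 (by linarith) ht20 (by linarith) hr0 (by linarith)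
  have hWs := E3_W_sign Z0 Lo0 Ho0 (Z0 - Lo0 - Ho0) q (1 - q) r (1 - r) t1 (1 - t1) t2 (1 - t2) hZ rfl rfl rfl rfl
    hLo hHo hN hq0 (by linarith) ht10 (by linarith) ht20 (by linarith) hr0 (by linarith)
  have hHL := E3_cHL_sign Z0 Lo0 Ho0 (Z0 - Lo0 - Ho0) q (1 - q) r (1 - r) t1 (1 - t1) t2 (1 - t2) hZ rfl rfl rfl rfl
    hLo hHo hN hq0 (by linarith) ht10 (by linarith) ht20 (by linarith) hr0 (by linarith)
  have hLH := E3_cLH_sign Z0 Lo0 Ho0 (Z0 - Lo0 - Ho0) q (1 - q) r (1 - r) t1 (1 - t1) t2 (1 - t2) hZ rfl rfl rfl rfl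
    hLo hHo hN hq0 (by linarith) ht10 (by linarith) ht20 (by linarith) hr0 (by linarith)
  have hsum : 0 ≤ Z0 * Z0 * (Gc3_mix Zq Loq Hoq Lbq Hbq LLq LHq HLq HHq Z1 L1 Wq r t1 t2 * N3_mix Z0 Lo0 Ho0 Lb0 Hb0 LL0 LH0 HL0 HH0 Z1 L1 W r t1 t2 -
      (1 - q) * Gc3_mix Z0 Lo0 Ho0 Lb0 Hb0 LL0 LH0 HL0 HH0 Z1 L1 W r t1 t2 * N3_mix Zq Loq Hoq Lbq Hbq LLq LHq HLq HHq Z1 L1 Wq r t1 t2) := by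
    rw [hA]
    exact add_nonneg (add_nonneg (add_nonneg (add_nonneg (mul_nonneg hHH hsHH) (mul_nonneg hLL hsLL))
      (mul_nonneg_of_nonpos_of_nonpos hHL hsHL)) (mul_nonneg_of_nonpos_of_nonpos hLH hsLH)) (mul_nonneg hWs hW)
  have hZ2 : 0 < Z0 * Z0 := mul_pos hZ0 hZ0
  have h := (mul_nonneg_iff_of_pos_left hZ2).1 hsum
  linarith

end Key

end OStar3

end Mix

end Summit.Ventures.PercRepro2
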